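import Mathlib
import Literature.Computability.AlgebraicComplexity.DetReprEquivalent
import Literature.Computability.AlgebraicComplexity.EquivariantDC
import Literature.Computability.AlgebraicComplexity.GrenetEquivariant
import Summits.ValiantsHypothesis.ValiantsHypothesis.Theorems.SymPencilSymmetrizePermPairsInducedBlockPencilPerm

/-!
# `SymPencil.SymmetrizePermPairs` (stmt-ValiantsHypothesis-17793), stub `stub_induce` — (C3c) CURRENCY BRIDGE and
# (C3d) RESCALING

Desk RULING #198 (my book), p7 g11's sizing memo `HOME/lmr/NOTE-p7g11-17793-C3-equivariantGKKP-sizing.md` §2 (C3c)/(C3d).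

(C3c) **Currency bridge.**  The circuit / DAG side of (C3) ((C3a)/(C3b), p7's [Q1]–[Q3]) delivers a pencil `A` whose
symmetry under a row/column permutation pair `(π, ρ)` is written in RENAME form — `A(x_{π i, ρ j}) = g · A · h⁻¹` with
constant `g, h` (for the constructions at hand: a permutation CONGRUENCE `P_θ A P_θᵀ`, or plainly a re-indexing
`A.submatrix θ θ`).  The crux speaks `IsEquivariantDetRepr (Γ_n) f A` with `Γ_n ≤ GL(n², ℂ)` the closure of the permutation
matrices of `π × ρ` (the Birth skeleton's `permPairSubst n`, written out) acting by `linSubst`.  The bridge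
(`isEquivariantDetRepr_permPairs_of_rename_lifts`, `…_of_permCongruence`, `…_of_submatrix`) is `linSubst_permMatrix`
(`P_e · f = rename e⁻¹ f`) + `IsEquivariantDetRepr.of_generators`; permutation matrices are packaged as units with inverse the
transpose (`Matrix.transpose_permMatrix`, `Matrix.permMatrix_mul`).

(C3d) **Rescaling + size arithmetic.**  A pencil with `det A = C c · f`, `c ≠ 0`, of size `m ≥ 1` becomes one with `det = f` after multiplication
by a scalar `m`-th root of `c⁻¹` (`IsAlgClosed.exists_pow_nat_eq`); affineness, symmetry and all lifts survive
(`rescale_lifts`), so `IsEquivariantDetRepr Γ f (μ • A)` (`isEquivariantDetRepr_rescale`).  The wrapper `symmetric_equivariant_of_output`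
turns the expected output of (C3a)/(C3b) — a symmetric affine pencil with `det = C c · per_n` and permutation-congruence
covariance — into the conclusion of the memo's target (C3): `A‴.IsSymm ∧ IsEquivariantDetRepr Γ_n per_n A‴`, same size
(`…_submatrix` for re-indexing covariance, `…_reindex` for pencils on an arbitrary finite index type); `qp_poly_budget`:
`R ≤ N`, `M ≤ 2^((log₂ N + c)^c)` ⇒ `(R·M + 2)^e ≤ 2^((log₂ N + d)^d)` with `d = c + e + 4`.

(I1″) `inducedBlock_permPairs_submatrix`: the induced block family of a permified pencil ((I1′), p604733) with its covariance in
RE-INDEXING currency `B_i(x_{πa,ρb}) = (B_{τ i}).submatrix (P i) (P i)` — token-for-token the input of p7 g11's [Q3]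
`exists_isSymm_isEquivariantDetRepr_of_covariant_family`.

No `sorry`, no `def`.  Helper mode (`--supports stmt-ValiantsHypothesis-17793 --as helper`).  Honest framing: bookkeeping for an
OPEN stub; `stub_induce`, the crux `SymmetrizePermPairs`, `SdcThesis` and VP ≠ VNP are OPEN and NOT moved by this file.

## References
* [LandsbergRessayre2017] J. M. Landsberg, N. Ressayre, *Permanent v. determinant: an exponential lower bound assuming
  symmetry and a potential path towards Valiant's conjecture*, Differential Geom. Appl. 55 (2017), Def. 1.3.
-/

open Matrix MvPolynomial
open Literature.Computability.AlgebraicComplexity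

-- the mandated summit-side namespace repeats a component by design (single-problem summit)
set_option linter.dupNamespace false

namespace Summit.ValiantsHypothesis.ValiantsHypothesis.Theorems.SymPencilSymmetrizePermPairs.Currency

noncomputable section

/-! ### §1 (C3c) The currency bridge: rename-form lifts ⇒ `IsEquivariantDetRepr Γ_n` -/

/-- For `γ = P_{π × ρ}` the substitution `A(γ · x)` is the renaming `x_{ij} ↦ x_{π⁻¹ i, ρ⁻¹ j}` of the entries. [folklore] -/
theorem linSubstEntries_permPair {n : ℕ} {ι : Type*} (γ : GL (Fin n × Fin n) ℂ) (π ρ : Equiv.Perm (Fin n))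
    (hγ : (γ : Matrix (Fin n × Fin n) (Fin n × Fin n) ℂ) = Equiv.Perm.permMatrix ℂ (Equiv.prodCongr π ρ))
    (A : Matrix ι ι (MvPolynomial (Fin n × Fin n) ℂ)) :
    Matrix.linSubstEntries γ A =
      A.map (MvPolynomial.rename fun ij : Fin n × Fin n => (π.symm ij.1, ρ.symm ij.2)) := by
  ext i j
  simp only [Matrix.linSubstEntries, Matrix.map_apply, hγ, linSubst_permMatrix, Equiv.prodCongr_symm]
  rfl

/-- **(C3c), general form.**  Rename-form lifts for every permutation pair give `Γ_n`-equivariance in the crux's currency.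
[cite: LandsbergRessayre2017, Def. 1.3] -/
theorem isEquivariantDetRepr_permPairs_of_rename_lifts (n m : ℕ) (f : MvPolynomial (Fin n × Fin n) ℂ)
    (A : Matrix (Fin m) (Fin m) (MvPolynomial (Fin n × Fin n) ℂ)) (hA : IsAffineDetRepr f A)
    (hcov : ∀ π ρ : Equiv.Perm (Fin n), ∃ g h : GL (Fin m) ℂ,
      A.map (MvPolynomial.rename fun ij : Fin n × Fin n => (π ij.1, ρ ij.2)) =
        (g : Matrix (Fin m) (Fin m) ℂ).map C * A * ((h⁻¹ : GL (Fin m) ℂ) : Matrix (Fin m) (Fin m) ℂ).map C) :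
    IsEquivariantDetRepr (Subgroup.closure {γ : GL (Fin n × Fin n) ℂ | ∃ π ρ : Equiv.Perm (Fin n),
        (γ : Matrix (Fin n × Fin n) (Fin n × Fin n) ℂ) = Equiv.Perm.permMatrix ℂ (Equiv.prodCongr π ρ)}) f A := by
  refine IsEquivariantDetRepr.of_generators hA ?_
  rintro γ ⟨π, ρ, hγ⟩
  obtain ⟨g, h, hgh⟩ := hcov π.symm ρ.symm
  exact ⟨g, h, by rw [linSubstEntries_permPair γ π ρ hγ, hgh]⟩

/-- A permutation matrix as a unit of the matrix ring, with inverse its transpose. [folklore] -/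
theorem permMatrix_mul_transpose {m : ℕ} (θ : Equiv.Perm (Fin m)) :
    θ.permMatrix ℂ * (θ.permMatrix ℂ)ᵀ = 1 := by
  rw [Matrix.transpose_permMatrix, ← Matrix.permMatrix_mul, inv_mul_cancel, Matrix.permMatrix_one]

/-- … and on the other side. [folklore] -/
theorem permMatrix_transpose_mul {m : ℕ} (θ : Equiv.Perm (Fin m)) :
    (θ.permMatrix ℂ)ᵀ * θ.permMatrix ℂ = 1 := by
  rw [Matrix.transpose_permMatrix, ← Matrix.permMatrix_mul, mul_inv_cancel, Matrix.permMatrix_one]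

/-- **(C3c), permutation-congruence form** (the currency of p6 g12's permify files and of p7 g11's memo §1):
`A(x_{π i, ρ j}) = P_θ · A · P_θᵀ` for every pair `(π, ρ)` gives `Γ_n`-equivariance with exact linear lifts `(P_θ, P_θ)`.
[cite: LandsbergRessayre2017, Def. 1.3] -/
theorem isEquivariantDetRepr_permPairs_of_permCongruence (n m : ℕ) (f : MvPolynomial (Fin n × Fin n) ℂ)
    (A : Matrix (Fin m) (Fin m) (MvPolynomial (Fin n × Fin n) ℂ)) (hA : IsAffineDetRepr f A)
    (hcov : ∀ π ρ : Equiv.Perm (Fin n), ∃ θ : Equiv.Perm (Fin m),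
      A.map (MvPolynomial.rename fun ij : Fin n × Fin n => (π ij.1, ρ ij.2)) =
        (θ.permMatrix ℂ).map C * A * ((θ.permMatrix ℂ)ᵀ).map C) :
    IsEquivariantDetRepr (Subgroup.closure {γ : GL (Fin n × Fin n) ℂ | ∃ π ρ : Equiv.Perm (Fin n),
        (γ : Matrix (Fin n × Fin n) (Fin n × Fin n) ℂ) = Equiv.Perm.permMatrix ℂ (Equiv.prodCongr π ρ)}) f A := by
  refine isEquivariantDetRepr_permPairs_of_rename_lifts n m f A hA fun π ρ => ?_
  obtain ⟨θ, hθ⟩ := hcov π ρ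
  let P : GL (Fin m) ℂ :=
    ⟨θ.permMatrix ℂ, (θ.permMatrix ℂ)ᵀ, permMatrix_mul_transpose θ, permMatrix_transpose_mul θ⟩
  exact ⟨P, P, hθ⟩

/-- Re-indexing by `θ` on both sides is the permutation congruence by `P_θ`. [folklore] -/
theorem submatrix_eq_permMatrix_mul {m : ℕ} {R : Type*} [CommRing R] (M : Matrix (Fin m) (Fin m) R)
    (θ : Equiv.Perm (Fin m)) :
    M.submatrix θ θ = θ.permMatrix R * M * (θ.permMatrix R)ᵀ := by
  rw [Matrix.transpose_permMatrix, Equiv.Perm.permMatrix, Equiv.Perm.permMatrix, Matrix.mul_assoc,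
    PEquiv.mul_toMatrix_toPEquiv, PEquiv.toMatrix_toPEquiv_mul, Matrix.submatrix_submatrix]
  simp [Equiv.Perm.inv_def]

/-- **(C3c), re-indexing form**: `A(x_{π i, ρ j}) = A.submatrix θ θ` for every pair gives `Γ_n`-equivariance.
[cite: LandsbergRessayre2017, Def. 1.3] -/
theorem isEquivariantDetRepr_permPairs_of_submatrix (n m : ℕ) (f : MvPolynomial (Fin n × Fin n) ℂ)
    (A : Matrix (Fin m) (Fin m) (MvPolynomial (Fin n × Fin n) ℂ)) (hA : IsAffineDetRepr f A)
    (hcov : ∀ π ρ : Equiv.Perm (Fin n), ∃ θ : Equiv.Perm (Fin m),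
      A.map (MvPolynomial.rename fun ij : Fin n × Fin n => (π ij.1, ρ ij.2)) = A.submatrix θ θ) :
    IsEquivariantDetRepr (Subgroup.closure {γ : GL (Fin n × Fin n) ℂ | ∃ π ρ : Equiv.Perm (Fin n),
        (γ : Matrix (Fin n × Fin n) (Fin n × Fin n) ℂ) = Equiv.Perm.permMatrix ℂ (Equiv.prodCongr π ρ)}) f A := by
  refine isEquivariantDetRepr_permPairs_of_permCongruence n m f A hA fun π ρ => ?_
  obtain ⟨θ, hθ⟩ := hcov π ρ
  refine ⟨θ, ?_⟩
  have hP : (θ.permMatrix ℂ).map (C : ℂ → MvPolynomial (Fin n × Fin n) ℂ) =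
      θ.permMatrix (MvPolynomial (Fin n × Fin n) ℂ) :=
    PEquiv.map_toMatrix (C : ℂ →+* MvPolynomial (Fin n × Fin n) ℂ) θ.toPEquiv
  rw [hθ, Matrix.transpose_map, hP, submatrix_eq_permMatrix_mul]

/-! ### §2 (C3d) Rescaling the determinant by a unit -/

section Rescale

variable {σ : Type*} [Fintype σ] [DecidableEq σ] {m : ℕ}

/-- Scalars pass through substitutions: `(μ • A)(γ · x) = μ • A(γ · x)`. [folklore] -/
theorem linSubstEntries_smul (γ : GL σ ℂ) (μ : ℂ) (A : Matrix (Fin m) (Fin m) (MvPolynomial σ ℂ)) :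
    Matrix.linSubstEntries γ ((C μ : MvPolynomial σ ℂ) • A) = (C μ : MvPolynomial σ ℂ) • Matrix.linSubstEntries γ A := by
  ext i j
  simp only [Matrix.linSubstEntries, Matrix.map_apply, Matrix.smul_apply, smul_eq_mul, map_mul, linSubst_C]

/-- Lifts survive rescaling: `(μA)(γx) = g (μA) h⁻¹` whenever `A(γx) = g A h⁻¹`. [folklore] -/
theorem rescale_lifts (Γ : Subgroup (GL σ ℂ)) (μ : ℂ) (A : Matrix (Fin m) (Fin m) (MvPolynomial σ ℂ))
    (hlift : ∀ γ ∈ Γ, ∃ g h : GL (Fin m) ℂ,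
      Matrix.linSubstEntries γ A =
        (g : Matrix (Fin m) (Fin m) ℂ).map C * A * ((h⁻¹ : GL (Fin m) ℂ) : Matrix (Fin m) (Fin m) ℂ).map C) :
    ∀ γ ∈ Γ, ∃ g h : GL (Fin m) ℂ,
      Matrix.linSubstEntries γ ((C μ : MvPolynomial σ ℂ) • A) =
        (g : Matrix (Fin m) (Fin m) ℂ).map C * ((C μ : MvPolynomial σ ℂ) • A) *
          ((h⁻¹ : GL (Fin m) ℂ) : Matrix (Fin m) (Fin m) ℂ).map C := by
  intro γ hγ
  obtain ⟨g, h, hgh⟩ := hlift γ hγ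
  refine ⟨g, h, ?_⟩
  rw [linSubstEntries_smul, hgh, Matrix.mul_smul, Matrix.smul_mul]

/-- **(C3d) Rescaling.**  An affine pencil of size `m ≥ 1` with `det A = C c · f`, `c ≠ 0`, and `Γ`-lifts rescales (by an `m`-th
root of `c⁻¹`, `ℂ` algebraically closed) to a `Γ`-equivariant affine determinantal representation of `f` of the SAME size;
symmetry is kept. [folklore] -/
theorem isEquivariantDetRepr_rescale (Γ : Subgroup (GL σ ℂ)) (A : Matrix (Fin m) (Fin m) (MvPolynomial σ ℂ))
    (f : MvPolynomial σ ℂ) (c : ℂ) (hc : c ≠ 0) (hm : 0 < m)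
    (haff : ∀ i j, (A i j).totalDegree ≤ 1) (hdet : A.det = C c * f)
    (hlift : ∀ γ ∈ Γ, ∃ g h : GL (Fin m) ℂ,
      Matrix.linSubstEntries γ A =
        (g : Matrix (Fin m) (Fin m) ℂ).map C * A * ((h⁻¹ : GL (Fin m) ℂ) : Matrix (Fin m) (Fin m) ℂ).map C) :
    ∃ A' : Matrix (Fin m) (Fin m) (MvPolynomial σ ℂ), IsEquivariantDetRepr Γ f A' ∧ (A.IsSymm → A'.IsSymm) := by
  -- an `m`-th root of `c⁻¹`
  obtain ⟨μ, hμ⟩ := IsAlgClosed.exists_pow_nat_eq c⁻¹ hm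
  refine ⟨(C μ : MvPolynomial σ ℂ) • A, ⟨⟨fun i j => ?_, ?_⟩, rescale_lifts Γ μ A hlift⟩, fun hs => ?_⟩
  · -- affine
    rw [Matrix.smul_apply, smul_eq_mul]
    exact (totalDegree_mul _ _).trans (by rw [totalDegree_C, zero_add]; exact haff i j)
  · -- determinant
    rw [Matrix.det_smul, hdet, Fintype.card_fin, ← map_pow, hμ, ← mul_assoc, ← map_mul, inv_mul_cancel₀ hc, map_one,
      one_mul]
  · -- symmetry
    exact hs.smul _

end Rescale

/-! ### §3 The wrapper for the (C3) target -/

/-- **(C3c) + (C3d) for the memo's target.**  A symmetric affine pencil `A` of size `m ≥ 1` with `det A = C c · per_n` (`c ≠ 0`,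
e.g. `c = 2R` from the layout determinant of the `R`-fold union) whose covariance under every row/column permutation pair is a
permutation congruence yields, at the SAME size, a symmetric `Γ_n`-equivariant affine determinantal representation of `per_n`
(`Γ_n` = the Birth skeleton's `permPairSubst n`, written out). [cite: LandsbergRessayre2017, Def. 1.3] -/
theorem symmetric_equivariant_of_output (n m : ℕ) (hm : 0 < m)
    (A : Matrix (Fin m) (Fin m) (MvPolynomial (Fin n × Fin n) ℂ)) (hsym : A.IsSymm)
    (haff : ∀ i j, (A i j).totalDegree ≤ 1) (c : ℂ) (hc : c ≠ 0) (hdet : A.det = C c * perPoly (Fin n) ℂ)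
    (hcov : ∀ π ρ : Equiv.Perm (Fin n), ∃ θ : Equiv.Perm (Fin m),
      A.map (MvPolynomial.rename fun ij : Fin n × Fin n => (π ij.1, ρ ij.2)) =
        (θ.permMatrix ℂ).map C * A * ((θ.permMatrix ℂ)ᵀ).map C) :
    ∃ A' : Matrix (Fin m) (Fin m) (MvPolynomial (Fin n × Fin n) ℂ), A'.IsSymm ∧
      IsEquivariantDetRepr (Subgroup.closure {γ : GL (Fin n × Fin n) ℂ | ∃ π ρ : Equiv.Perm (Fin n),
        (γ : Matrix (Fin n × Fin n) (Fin n × Fin n) ℂ) = Equiv.Perm.permMatrix ℂ (Equiv.prodCongr π ρ)})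
        (perPoly (Fin n) ℂ) A' := by
  -- lifts in `linSubst` currency for the pencil with determinant `C c · per_n`
  have hE := isEquivariantDetRepr_permPairs_of_permCongruence n m (C c * perPoly (Fin n) ℂ) A ⟨haff, hdet⟩ hcov
  obtain ⟨A', hA', hs⟩ := isEquivariantDetRepr_rescale _ A (perPoly (Fin n) ℂ) c hc hm haff hdet hE.2
  exact ⟨A', hs hsym, hA'⟩

/-- **(C3c) + (C3d), re-indexing form of the covariance** (`A(x_{π i, ρ j}) = A.submatrix θ θ`). [cite: LandsbergRessayre2017, Def. 1.3] -/
theorem symmetric_equivariant_of_output_submatrix (n m : ℕ) (hm : 0 < m)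
    (A : Matrix (Fin m) (Fin m) (MvPolynomial (Fin n × Fin n) ℂ)) (hsym : A.IsSymm)
    (haff : ∀ i j, (A i j).totalDegree ≤ 1) (c : ℂ) (hc : c ≠ 0) (hdet : A.det = C c * perPoly (Fin n) ℂ)
    (hcov : ∀ π ρ : Equiv.Perm (Fin n), ∃ θ : Equiv.Perm (Fin m),
      A.map (MvPolynomial.rename fun ij : Fin n × Fin n => (π ij.1, ρ ij.2)) = A.submatrix θ θ) :
    ∃ A' : Matrix (Fin m) (Fin m) (MvPolynomial (Fin n × Fin n) ℂ), A'.IsSymm ∧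
      IsEquivariantDetRepr (Subgroup.closure {γ : GL (Fin n × Fin n) ℂ | ∃ π ρ : Equiv.Perm (Fin n),
        (γ : Matrix (Fin n × Fin n) (Fin n × Fin n) ℂ) = Equiv.Perm.permMatrix ℂ (Equiv.prodCongr π ρ)})
        (perPoly (Fin n) ℂ) A' := by
  have hE := isEquivariantDetRepr_permPairs_of_submatrix n m (C c * perPoly (Fin n) ℂ) A ⟨haff, hdet⟩ hcov
  obtain ⟨A', hA', hs⟩ := isEquivariantDetRepr_rescale _ A (perPoly (Fin n) ℂ) c hc hm haff hdet hE.2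
  exact ⟨A', hs hsym, hA'⟩

/-! ### §4 Arbitrary index types: re-index to `Fin`, keeping the covariance -/

/-- Re-indexing a covariant matrix along `e : ι ≃ Fin m` conjugates the covariance permutation. [folklore] -/
theorem reindex_map_eq_submatrix {ι : Type*} {R : Type*} {m : ℕ} (f : R → R) (M : Matrix ι ι R) (θ : Equiv.Perm ι)
    (e : ι ≃ Fin m) (h : M.map f = M.submatrix θ θ) :
    (Matrix.reindex e e M).map f =
      (Matrix.reindex e e M).submatrix ((e.symm.trans θ).trans e) ((e.symm.trans θ).trans e) := by
  rw [Matrix.reindex_apply, ← Matrix.submatrix_map, h, Matrix.submatrix_submatrix, Matrix.submatrix_submatrix]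
  congr 1 <;> (funext x; simp)

/-- **(C3c) + (C3d) over an arbitrary finite index type** (the DAG pencils of [Q1]–[Q3] live on `Unit ⊕ (V ⊕ V)`-like types):
a symmetric affine matrix `M` on `ι` with `det M = C c · per_n` (`c ≠ 0`, `ι` non-empty) and re-indexing covariance
`M(x_{π i, ρ j}) = M.submatrix θ θ` for every pair yields a symmetric `Γ_n`-equivariant affine determinantal representation of
`per_n` of size `|ι|` (re-index by `Fintype.equivFin`, then `symmetric_equivariant_of_output_submatrix`).
[cite: LandsbergRessayre2017, Def. 1.3] -/
theorem symmetric_equivariant_of_output_reindex (n : ℕ) {ι : Type*} [Fintype ι] [DecidableEq ι] [Nonempty ι]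
    (M : Matrix ι ι (MvPolynomial (Fin n × Fin n) ℂ)) (hsym : M.IsSymm)
    (haff : ∀ i j, (M i j).totalDegree ≤ 1) (c : ℂ) (hc : c ≠ 0) (hdet : M.det = C c * perPoly (Fin n) ℂ)
    (hcov : ∀ π ρ : Equiv.Perm (Fin n), ∃ θ : Equiv.Perm ι,
      M.map (MvPolynomial.rename fun ij : Fin n × Fin n => (π ij.1, ρ ij.2)) = M.submatrix θ θ) :
    ∃ A' : Matrix (Fin (Fintype.card ι)) (Fin (Fintype.card ι)) (MvPolynomial (Fin n × Fin n) ℂ), A'.IsSymm ∧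
      IsEquivariantDetRepr (Subgroup.closure {γ : GL (Fin n × Fin n) ℂ | ∃ π ρ : Equiv.Perm (Fin n),
        (γ : Matrix (Fin n × Fin n) (Fin n × Fin n) ℂ) = Equiv.Perm.permMatrix ℂ (Equiv.prodCongr π ρ)})
        (perPoly (Fin n) ℂ) A' := by
  let e : ι ≃ Fin (Fintype.card ι) := Fintype.equivFin ι
  refine symmetric_equivariant_of_output_submatrix n (Fintype.card ι) Fintype.card_pos (Matrix.reindex e e M)
    ?_ (fun i j => ?_) c hc ?_ fun π ρ => ?_
  · -- symmetry
    show (Matrix.reindex e e M)ᵀ = Matrix.reindex e e M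
    rw [Matrix.transpose_reindex, hsym.eq]
  · -- affine
    rw [Matrix.reindex_apply, Matrix.submatrix_apply]; exact haff _ _
  · -- determinant
    rw [Matrix.det_reindex_self, hdet]
  · -- covariance
    obtain ⟨θ, hθ⟩ := hcov π ρ
    exact ⟨(e.symm.trans θ).trans e, reindex_map_eq_submatrix _ M θ e hθ⟩

/-! ### §5 (C3d) size arithmetic -/

/-- **(C3d) size arithmetic**: a polynomial of a quasi-polynomial is a quasi-polynomial — with `L = ⌊log₂ N⌋`,
`R ≤ N` and `M ≤ 2^((L + c)^c)` give `(R · M + 2)^e ≤ 2^((L + d)^d)` for `d = c + e + 4` (composing [A4]'s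
`m′ ≤ 2^((log₂(mR+m) + 2)^2)` with a polynomial pencil size `(R m′ + 2)^e` inside `stub_induce`'s budget). [folklore] -/
theorem qp_poly_budget (c e : ℕ) : ∃ d : ℕ, ∀ N M R : ℕ, R ≤ N → M ≤ 2 ^ ((Nat.log 2 N + c) ^ c) →
    (R * M + 2) ^ e ≤ 2 ^ ((Nat.log 2 N + d) ^ d) := by
  refine ⟨c + e + 4, fun N M R hR hM => ?_⟩
  set L := Nat.log 2 N with hL
  -- `N < 2^(L+1)`
  have hN : N < 2 ^ (L + 1) := Nat.lt_pow_succ_log_self (by norm_num) N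
  -- `R * M + 2 ≤ 2 ^ (L + 1 + (L+c)^c) + 2 ≤ 2 ^ (L + 3 + (L+c)^c)`
  have h1 : R * M + 2 ≤ 2 ^ (L + (L + c) ^ c + 3) := by
    calc R * M + 2 ≤ 2 ^ (L + 1) * 2 ^ ((L + c) ^ c) + 2 := by
          have := Nat.mul_le_mul (hR.trans hN.le) hM; omega
      _ = 2 ^ (L + 1 + (L + c) ^ c) + 2 := by rw [← pow_add]
      _ ≤ 2 ^ (L + 1 + (L + c) ^ c + 2) := by
          have h1 : 1 ≤ 2 ^ (L + 1 + (L + c) ^ c) := Nat.one_le_two_pow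
          have : 2 ^ (L + 1 + (L + c) ^ c + 2) = 4 * 2 ^ (L + 1 + (L + c) ^ c) := by ring
          omega
      _ = 2 ^ (L + (L + c) ^ c + 3) := by ring_nf
  -- exponent bookkeeping: `e * (L + (L+c)^c + 3) ≤ (L + (c+e+2))^(c+e+2)`
  have h2 : (L + c) ^ c ≤ (L + (c + e + 4)) ^ c := Nat.pow_le_pow_left (by omega) c
  have h3 : L + 3 ≤ L + (c + e + 4) + 1 := by omega
  have hbase : 1 ≤ L + (c + e + 4) := by omega
  have h4 : L + (L + c) ^ c + 3 ≤ (L + (c + e + 4)) ^ (c + 1) := by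
    -- `(B)^(c+1) = B^c * B ≥ B^c + B^c*(B-1) ≥ (L+c)^c + (B - 1) ≥ …` with `B = L + c + e + 4 ≥ L + 3 + … `
    have hBc : 1 ≤ (L + (c + e + 4)) ^ c := Nat.one_le_pow _ _ hbase
    have : (L + (c + e + 4)) ^ (c + 1) = (L + (c + e + 4)) ^ c * (L + (c + e + 4)) := pow_succ _ _
    have h5 : (L + (c + e + 4)) ^ c * (L + (c + e + 4)) ≥ (L + (c + e + 4)) ^ c + (L + (c + e + 4) - 1) := by
      have hB2 : 2 ≤ L + (c + e + 4) := by omega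
      -- x*y ≥ x + (y-1) for x ≥ 1, y ≥ 1
      have key : ∀ x y : ℕ, 1 ≤ x → 1 ≤ y → x + (y - 1) ≤ x * y := by
        intro x y hx hy
        have : x * y = x + x * (y - 1) := by
          rcases y with _ | y
          · omega
          · simp [Nat.mul_succ]; ring
        nlinarith
      exact key _ _ hBc hbase
    omega
  calc (R * M + 2) ^ e ≤ (2 ^ (L + (L + c) ^ c + 3)) ^ e := Nat.pow_le_pow_left h1 e
    _ = 2 ^ ((L + (L + c) ^ c + 3) * e) := by rw [← pow_mul]
    _ ≤ 2 ^ ((L + (c + e + 4)) ^ (c + 1) * (L + (c + e + 4))) := by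
        apply Nat.pow_le_pow_right (by norm_num)
        exact Nat.mul_le_mul h4 (by omega)
    _ = 2 ^ ((L + (c + e + 4)) ^ (c + 2)) := by rw [← pow_succ]
    _ ≤ 2 ^ ((L + (c + e + 4)) ^ (c + e + 4)) := by
        apply Nat.pow_le_pow_right (by norm_num)
        exact Nat.pow_le_pow_right hbase (by omega)


/-! ### §6 The induced family in re-indexing currency (the input of [Q3] `exists_isSymm_isEquivariantDetRepr_of_covariant_family`) -/

/-- Permutation congruence with `C`-mapped permutation matrices is re-indexing. [folklore] -/
theorem permMatrix_map_C_conj_eq_submatrix {m : ℕ} {σ : Type*} (M : Matrix (Fin m) (Fin m) (MvPolynomial σ ℂ))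
    (θ : Equiv.Perm (Fin m)) :
    (θ.permMatrix ℂ).map (C : ℂ → MvPolynomial σ ℂ) * M * ((θ.permMatrix ℂ)ᵀ).map C = M.submatrix θ θ := by
  have hP : (θ.permMatrix ℂ).map (C : ℂ → MvPolynomial σ ℂ) = θ.permMatrix (MvPolynomial σ ℂ) :=
    PEquiv.map_toMatrix (C : ℂ →+* MvPolynomial σ ℂ) θ.toPEquiv
  rw [Matrix.transpose_map, hP, submatrix_eq_permMatrix_mul]

/-- **(I1″) The induced block family of a permified pencil, in RE-INDEXING currency** — (I1′)
(`InducedBlock.inducedBlock_permPairs_perm`, p604733) with the covariance rewritten as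
`B_i(x_{π a, ρ b}) = (B_{τ i}).submatrix (P i) (P i)`: token-for-token the hypothesis of p7 g11's [Q3]
`exists_isSymm_isEquivariantDetRepr_of_covariant_family`. [cite: LandsbergRessayre2017, Def. 1.3] -/
theorem inducedBlock_permPairs_submatrix (n m : ℕ) (Γ Γ' : Subgroup (GL (Fin n × Fin n) ℂ))
    (hΓ : Γ = Subgroup.closure {γ : GL (Fin n × Fin n) ℂ | ∃ π ρ : Equiv.Perm (Fin n),
        (γ : Matrix (Fin n × Fin n) (Fin n × Fin n) ℂ) = Equiv.Perm.permMatrix ℂ (Equiv.prodCongr π ρ)})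
    [(Γ'.subgroupOf Γ).FiniteIndex]
    (A : Matrix (Fin m) (Fin m) (MvPolynomial (Fin n × Fin n) ℂ)) (hA : IsAffineDetRepr (perPoly (Fin n) ℂ) A)
    (hperm : ∀ γ ∈ Γ', ∃ σ : Equiv.Perm (Fin m),
      Matrix.linSubstEntries γ A = (σ.permMatrix ℂ).map C * A * ((σ.permMatrix ℂ)ᵀ).map C) :
    ∃ B : Fin (Γ'.relIndex Γ) → Matrix (Fin m) (Fin m) (MvPolynomial (Fin n × Fin n) ℂ),
      (∀ i, IsAffineDetRepr (perPoly (Fin n) ℂ) (B i)) ∧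
      (∀ π ρ : Equiv.Perm (Fin n), ∃ (τ : Equiv.Perm (Fin (Γ'.relIndex Γ)))
          (P : Fin (Γ'.relIndex Γ) → Equiv.Perm (Fin m)), ∀ i,
        (B i).map (MvPolynomial.rename fun ij : Fin n × Fin n => (π ij.1, ρ ij.2)) = (B (τ i)).submatrix (P i) (P i)) ∧
      (∀ i, ∃ g ∈ Γ, B i = Matrix.linSubstEntries g A) ∧
      (A.IsSymm → ∀ i, (B i).IsSymm) := by
  obtain ⟨B, haff, hcov, htr, hsym⟩ := InducedBlock.inducedBlock_permPairs_perm n m Γ Γ' hΓ A hA hperm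
  refine ⟨B, haff, fun π ρ => ?_, htr, hsym⟩
  obtain ⟨τ, P, h⟩ := hcov π ρ
  exact ⟨τ, P, fun i => by rw [h i, permMatrix_map_C_conj_eq_submatrix]⟩

end

end Summit.ValiantsHypothesis.ValiantsHypothesis.Theorems.SymPencilSymmetrizePermPairs.Currency
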